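import Mathlib
import Summits.NavierStokesRegularity.NavierStokesRegularity.Theorems.ThreadingFluxHorizonTowerDefs
import HarnessLib

/-!
# Crux `PoloidalLiouville` (stmt-NavierStokesRegularity-1222, wall W1), crux idea «horizon-threading-tower» (ns-idea-15):
# the HORIZON SIEVE follows from the blow-down form of the order-two horizon law, BY NAME

Support file (Theorems-side tooling; seat ns-wall-eng-4 g2, cell ns-wall-extremal, W1 adjunct; `--supports stmt-NavierStokesRegularity-1222
--as helper`).  The card's rung «`HorizonSieve` (S given the blow-down law)» as a kernel implication between the typed statements of
`Theorems/ThreadingFluxHorizonTowerDefs.lean`: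

* ★ `HorizonTower.horizonSieve_of_orderTwoHorizonLawBlowdown : OrderTwoHorizonLawBlowdown → HorizonSieve` — under the hypotheses of
  `PoloidalLiouville` with a classical pressure on `(−∞, 0)`, every homogeneous blow-down limit of every slice is annihilated by both horizon laws,
  GIVEN the blow-down law (window `S = (−∞, 0)`; unthreadedness `⟪x − x₀, curl v(t) x⟫ = 0` is the vanishing of `threadingFlux`).  The boundedness
  hypothesis of the sieve is not used.

HONEST LABEL: a CONDITIONAL rung (the lever `OrderTwoHorizonLawBlowdown` is NOT proved here or anywhere in the tree); information-grade for W1/W2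
(movement 0); `PoloidalLiouville` (1222), `UnthreadedRigidity` (27585) and NS regularity remain OPEN and untouched.
[cite: MajdaBertozziCUP2002, §1.1 (vector identities)]
-/

-- the summit and its single problem share the name (D-0017 nested layout)
set_option linter.dupNamespace false

noncomputable section

open Set Function Filter Topology
open scoped Topology RealInnerProductSpace
open Literature.Analysis.FluidPDE

namespace Summit.NavierStokesRegularity.NavierStokesRegularity.Theorems.PoloidalLiouville.HorizonTower

/-- ★ **`OrderTwoHorizonLawBlowdown → HorizonSieve`** (the card's rung «HorizonSieve, S given the blow-down law», by name): take the open
window `S = (−∞, 0)`, on which the sieve's solution is classical and unthreaded about `x₀` at all times. -/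
theorem horizonSieve_of_orderTwoHorizonLawBlowdown (hlaw : OrderTwoHorizonLawBlowdown) : HorizonSieve := by
  intro v p x₀ _hbdd hcl hunthr t₀ ht₀ U P₀ s₀ hU hP₀ hblow y hy
  refine hlaw (Set.Iio 0) v p x₀ t₀ U P₀ s₀ isOpen_Iio ht₀ hcl ?_ hU hP₀ hblow y hy
  intro t ht x
  unfold threadingFlux
  rw [real_inner_comm]
  exact hunthr t ht x

end Summit.NavierStokesRegularity.NavierStokesRegularity.Theorems.PoloidalLiouville.HorizonTower

end
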